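import Summits.ValiantsHypothesis.ValiantsHypothesis.Theorems.KPlusLogSqLawStaticPathGlueAdjacent
import Summits.ValiantsHypothesis.ValiantsHypothesis.Theorems.KPlusLogSqLawStaticPathCertFifteenEnds
import Summits.ValiantsHypothesis.ValiantsHypothesis.Theorems.KPlusLogSqLawStaticPathChainFloor

/-!
# Route «KPlusLogSqLaw» — all-`n` floors from ONE certificate WITHOUT the separator loss: `26·⌊m/15⌋` changes on every `m`-block (rate 26/15)

HONEST FRAMING.  Helper toward the crux `WeakLifting` (item `stmt-ValiantsHypothesis-19561`, route `KPlusLogSqLaw`, cell `pub-symmetroid`,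
seat val-sym-lift-p4 g9, 2026-08-27): tropical twin of the STATIC tridiagonal sector = parametric max-weight independent set on a path.
With the separator-free gluing theorem (`exists_chain_ends_add`) a chain certificate «with free ends» (first optimum avoiding item `1`, last
optimum avoiding the last item) of `N` changes on `n` items gives `N k` changes on `n k` items for every `k` (`exists_chain_ends_mul`) — rate
`N / n` instead of `chain_glue`'s `N / (n + 1)`.  TIME REVERSAL (`exists_chain_ends_of_rev_ends`: `θ ↦ -θ`, slopes negated, samples and optima
read backwards) turns the `n = 15` certificate (first optimum avoids `15`, last avoids `1`: `exists_chain_twentysix_on_fifteen_rev_ends`) into one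
with free ends, whence the kernel floor **`26·⌊m/15⌋` changes of the unique optimum on every block of `m` items** (`exists_chain_floor_fifteen_adj`,
rate `26/15 ≈ 1.733`; previous best `26·⌊(m+1)/16⌋`, rate `13/8`; located truth `2n - 4` for `5 ≤ n ≤ 15`, F6 family `11n/6 - 10`).  By the
same superadditivity the limit `c* = lim bp(n)/n` of the maximal chain length exists and bounds every instance (`bp(n) ≤ c*·n`); this file does
not define `bp`.  Nothing here asserts anything about `WeakLifting`, `TropicalB`, `KPlusLogSqLaw`, `MatrixDescartes` (stmt-ValiantsHypothesis-18050)
or `VP ≠ VNP`.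
-/

set_option linter.dupNamespace false
set_option autoImplicit false

namespace Summit.ValiantsHypothesis.ValiantsHypothesis.Theorems.KPlusLogSqLaw

open Finset Classical

namespace StaticPathFold

noncomputable section

/-- transport of a chain «with free ends» along equalities of the item and change counts. [folklore] -/
theorem chain_ends_congr {n n' N N' : ℕ} (hn : n = n') (hN : N = N')
    (h : ∃ (w₁ w₀ : ℕ → ℝ) (θs : Fin (N + 1) → ℝ) (Ms : Fin (N + 1) → Finset ℕ),
      StrictMono θs ∧ (∀ k, Ms k ∈ indepSets 0 n) ∧
      (∀ k, ∀ S ∈ indepSets 0 n, S ≠ Ms k → ∑ t ∈ S, W w₁ w₀ t (θs k) < ∑ t ∈ Ms k, W w₁ w₀ t (θs k)) ∧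
      (∀ e : Fin N, Ms e.castSucc ≠ Ms e.succ) ∧ 1 ∉ Ms 0 ∧ n ∉ Ms (Fin.last N)) :
    ∃ (w₁ w₀ : ℕ → ℝ) (θs : Fin (N' + 1) → ℝ) (Ms : Fin (N' + 1) → Finset ℕ),
      StrictMono θs ∧ (∀ k, Ms k ∈ indepSets 0 n') ∧
      (∀ k, ∀ S ∈ indepSets 0 n', S ≠ Ms k → ∑ t ∈ S, W w₁ w₀ t (θs k) < ∑ t ∈ Ms k, W w₁ w₀ t (θs k)) ∧
      (∀ e : Fin N', Ms e.castSucc ≠ Ms e.succ) ∧ 1 ∉ Ms 0 ∧ n' ∉ Ms (Fin.last N') := by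
  subst hn hN; exact h

/-- **TIME REVERSAL.**  Reading a chain backwards (`θ ↦ -θ`, slopes negated) is a chain; a first optimum avoiding the LAST item and a last
optimum avoiding item `1` become free ends. [folklore] -/
theorem exists_chain_ends_of_rev_ends {n N : ℕ}
    (h : ∃ (w₁ w₀ : ℕ → ℝ) (θs : Fin (N + 1) → ℝ) (Ms : Fin (N + 1) → Finset ℕ),
      StrictMono θs ∧ (∀ k, Ms k ∈ indepSets 0 n) ∧
      (∀ k, ∀ S ∈ indepSets 0 n, S ≠ Ms k → ∑ t ∈ S, W w₁ w₀ t (θs k) < ∑ t ∈ Ms k, W w₁ w₀ t (θs k)) ∧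
      (∀ e : Fin N, Ms e.castSucc ≠ Ms e.succ) ∧ n ∉ Ms 0 ∧ 1 ∉ Ms (Fin.last N)) :
    ∃ (w₁ w₀ : ℕ → ℝ) (θs : Fin (N + 1) → ℝ) (Ms : Fin (N + 1) → Finset ℕ),
      StrictMono θs ∧ (∀ k, Ms k ∈ indepSets 0 n) ∧
      (∀ k, ∀ S ∈ indepSets 0 n, S ≠ Ms k → ∑ t ∈ S, W w₁ w₀ t (θs k) < ∑ t ∈ Ms k, W w₁ w₀ t (θs k)) ∧
      (∀ e : Fin N, Ms e.castSucc ≠ Ms e.succ) ∧ 1 ∉ Ms 0 ∧ n ∉ Ms (Fin.last N) := by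
  obtain ⟨w₁, w₀, θs, Ms, hθ, hM, hU, hs, h0, hl⟩ := h
  have hW : ∀ t θ, W (fun s => -w₁ s) w₀ t (-θ) = W w₁ w₀ t θ := by
    intro t θ; simp only [W]; ring
  refine ⟨fun s => -w₁ s, w₀, fun k => -θs (Fin.rev k), fun k => Ms (Fin.rev k), fun k l hkl => ?_, fun k => hM _,
    fun k S hS hne => ?_, fun e => ?_, ?_, ?_⟩
  · exact neg_lt_neg (hθ (Fin.rev_lt_rev.mpr hkl))
  · have h1 : ∑ t ∈ S, W (fun s => -w₁ s) w₀ t (-θs (Fin.rev k)) = ∑ t ∈ S, W w₁ w₀ t (θs (Fin.rev k)) :=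
      Finset.sum_congr rfl fun t _ => hW t _
    have h2 : ∑ t ∈ Ms (Fin.rev k), W (fun s => -w₁ s) w₀ t (-θs (Fin.rev k)) =
        ∑ t ∈ Ms (Fin.rev k), W w₁ w₀ t (θs (Fin.rev k)) :=
      Finset.sum_congr rfl fun t _ => hW t _
    rw [h1, h2]; exact hU _ S hS hne
  · show Ms (Fin.rev e.castSucc) ≠ Ms (Fin.rev e.succ)
    rw [Fin.rev_castSucc, Fin.rev_succ]; exact (hs (Fin.rev e)).symm
  · show 1 ∉ Ms (Fin.rev 0)
    rw [Fin.rev_zero]; exact hl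
  · show n ∉ Ms (Fin.rev (Fin.last N))
    rw [Fin.rev_last]; exact h0

/-- **the `n = 15` certificate with free ends** (time-reversed located maximiser): 26 changes on 15 items, first optimum avoiding item `1`,
last optimum avoiding item `15`. [folklore] -/
theorem exists_chain_ends_fifteen :
    ∃ (w₁ w₀ : ℕ → ℝ) (θs : Fin (26 + 1) → ℝ) (Ms : Fin (26 + 1) → Finset ℕ),
      StrictMono θs ∧ (∀ k, Ms k ∈ indepSets 0 15) ∧
      (∀ k, ∀ S ∈ indepSets 0 15, S ≠ Ms k → ∑ t ∈ S, W w₁ w₀ t (θs k) < ∑ t ∈ Ms k, W w₁ w₀ t (θs k)) ∧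
      (∀ e : Fin 26, Ms e.castSucc ≠ Ms e.succ) ∧ 1 ∉ Ms 0 ∧ 15 ∉ Ms (Fin.last 26) :=
  exists_chain_ends_of_rev_ends exists_chain_twentysix_on_fifteen_rev_ends

/-- **blocks without loss**: `k + 1` copies of a free-ends chain of `N` changes on `n` items give a free-ends chain of `N (k+1)` changes on
`n (k+1)` items. [folklore] -/
theorem exists_chain_ends_mul {n N : ℕ}
    (h : ∃ (w₁ w₀ : ℕ → ℝ) (θs : Fin (N + 1) → ℝ) (Ms : Fin (N + 1) → Finset ℕ),
      StrictMono θs ∧ (∀ k, Ms k ∈ indepSets 0 n) ∧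
      (∀ k, ∀ S ∈ indepSets 0 n, S ≠ Ms k → ∑ t ∈ S, W w₁ w₀ t (θs k) < ∑ t ∈ Ms k, W w₁ w₀ t (θs k)) ∧
      (∀ e : Fin N, Ms e.castSucc ≠ Ms e.succ) ∧ 1 ∉ Ms 0 ∧ n ∉ Ms (Fin.last N)) :
    ∀ k : ℕ, ∃ (w₁ w₀ : ℕ → ℝ) (θs : Fin (N * (k + 1) + 1) → ℝ) (Ms : Fin (N * (k + 1) + 1) → Finset ℕ),
      StrictMono θs ∧ (∀ j, Ms j ∈ indepSets 0 (n * (k + 1))) ∧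
      (∀ j, ∀ S ∈ indepSets 0 (n * (k + 1)), S ≠ Ms j →
        ∑ t ∈ S, W w₁ w₀ t (θs j) < ∑ t ∈ Ms j, W w₁ w₀ t (θs j)) ∧
      (∀ e : Fin (N * (k + 1)), Ms e.castSucc ≠ Ms e.succ) ∧ 1 ∉ Ms 0 ∧ n * (k + 1) ∉ Ms (Fin.last (N * (k + 1)))
  | 0 => chain_ends_congr (by ring) (by ring) h
  | k + 1 => chain_ends_congr (by ring) (by ring) (exists_chain_ends_add (exists_chain_ends_mul h k) h)

/-- **FLOOR WITHOUT LOSS**: a free-ends chain of `N` changes on `n` items gives, on EVERY block of `m` items, a chain of `N·⌊m/n⌋`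
changes of the unique optimum (copies glued without separators, then padded). [folklore] -/
theorem exists_chain_floor_adj {n N : ℕ}
    (h : ∃ (w₁ w₀ : ℕ → ℝ) (θs : Fin (N + 1) → ℝ) (Ms : Fin (N + 1) → Finset ℕ),
      StrictMono θs ∧ (∀ k, Ms k ∈ indepSets 0 n) ∧
      (∀ k, ∀ S ∈ indepSets 0 n, S ≠ Ms k → ∑ t ∈ S, W w₁ w₀ t (θs k) < ∑ t ∈ Ms k, W w₁ w₀ t (θs k)) ∧
      (∀ e : Fin N, Ms e.castSucc ≠ Ms e.succ) ∧ 1 ∉ Ms 0 ∧ n ∉ Ms (Fin.last N)) (m : ℕ) :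
    ∃ (w₁ w₀ : ℕ → ℝ) (θs : Fin (N * (m / n) + 1) → ℝ) (Ms : Fin (N * (m / n) + 1) → Finset ℕ),
      StrictMono θs ∧ (∀ j, Ms j ∈ indepSets 0 m) ∧
      (∀ j, ∀ S ∈ indepSets 0 m, S ≠ Ms j → ∑ t ∈ S, W w₁ w₀ t (θs j) < ∑ t ∈ Ms j, W w₁ w₀ t (θs j)) ∧
      (∀ e : Fin (N * (m / n)), Ms e.castSucc ≠ Ms e.succ) := by
  rcases Nat.eq_zero_or_pos (m / n) with hq | hq
  · rw [hq, Nat.mul_zero]; exact exists_chain_zero m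
  · obtain ⟨k, hk⟩ : ∃ k, m / n = k + 1 := ⟨m / n - 1, by omega⟩
    rw [hk]
    obtain ⟨w₁, w₀, θs, Ms, h1, h2, h3, h4, -, -⟩ := exists_chain_ends_mul h k
    have hle : n * (k + 1) ≤ m := by
      have := Nat.div_mul_le_self m n
      rw [hk] at this
      simpa [Nat.mul_comm] using this
    rcases Nat.eq_or_lt_of_le hle with heq | hlt
    · exact chain_congr heq rfl ⟨w₁, w₀, θs, Ms, h1, h2, h3, h4⟩
    · exact chain_congr (by omega) rfl (exists_chain_pad ⟨w₁, w₀, θs, Ms, h1, h2, h3, h4⟩ (m - n * (k + 1) - 1))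

/-- **KERNEL FLOOR `26·⌊m/15⌋` ON EVERY `m`-BLOCK** (from the located `n = 15` maximiser glued to itself without separators; rate `26/15`,
the sector's best kernel floor; located truth `2n - 4` for `5 ≤ n ≤ 15`). [folklore] -/
theorem exists_chain_floor_fifteen_adj (m : ℕ) :
    ∃ (w₁ w₀ : ℕ → ℝ) (θs : Fin (26 * (m / 15) + 1) → ℝ) (Ms : Fin (26 * (m / 15) + 1) → Finset ℕ),
      StrictMono θs ∧ (∀ j, Ms j ∈ indepSets 0 m) ∧
      (∀ j, ∀ S ∈ indepSets 0 m, S ≠ Ms j → ∑ t ∈ S, W w₁ w₀ t (θs j) < ∑ t ∈ Ms j, W w₁ w₀ t (θs j)) ∧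
      (∀ e : Fin (26 * (m / 15)), Ms e.castSucc ≠ Ms e.succ) :=
  exists_chain_floor_adj exists_chain_ends_fifteen m

/-- the rate of the floor: `26·⌊m/15⌋ ≥ (26 m - 364)/15`, i.e. asymptotic rate `26/15` changes per item. [folklore] -/
theorem floor_fifteen_adj_rate (m : ℕ) : 26 * m ≤ 15 * (26 * (m / 15)) + 364 := by
  have := Nat.div_add_mod m 15
  have := Nat.mod_lt m (show 0 < 15 by norm_num)
  omega

end

end StaticPathFold

end Summit.ValiantsHypothesis.ValiantsHypothesis.Theorems.KPlusLogSqLaw
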